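import Literature.Probability.Percolation.ArmSeparationOutSepFour
import HarnessLib

/-!
# Directed arcs of the thin ring and the assembly of staircase corridors

Topic: Probability / Percolation; family `crit-perc`. A brick of the GENERIC landing layer of
Nolin's arm-separation theorem (Nolin 2008, Thm. 11, §4.3 Prop. 12 and §4.4 [arXiv 0711.4948:
Prop. 11, Thm. 10, p. 12, Fig. 6: "RSW in corridors"]), towards
`Literature.Probability.Percolation.Nolin2008_prop17_quasiMult` (`FiveArmExponentFacts.lean`).

A staircase corridor is a chain: on each level a DIRECTED arc of the thin ring
`thinRing r e s` (from the ring position `g₁` to the ring position `g₂`, counterclockwise —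
increasing positions, cyclically — or clockwise), then a level connector
(`StaircaseConnectors.lean`), then the arc of the next level, and so on. This file provides the
directed arcs (`Staircase.darc`) with their chain property, their end tubes and their positions,
and the assembly lemma `Staircase.isChain_append_conn` joining two chains through a connector
crossing the last tube of the first and the first tube of the second.

## Main definitions

* `Staircase.ccwLen G g₁ g₂` — the number of tubes from `g₁` up to `g₂` cyclically (`G` tubes);
* `Staircase.darc r e s g₁ g₂ cw` — the directed arc from `g₁` to `g₂`.

## Main results

* `Staircase.isChain_darc` — directed arcs are chains;
* `Staircase.head?_darc`, `Staircase.getLast?_darc` — their end tubes are `ringTube … g₁/g₂`;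
* `Staircase.exists_pos_of_mem_darc` — their tubes are ring tubes at positions on the arc;
* `Staircase.isChain_append_conn` — assembly through a connector.

## References

* P. Nolin, *Near-critical percolation in two dimensions*, Electron. J. Probab. 13 (2008), §4.3
  Prop. 12 (proof), §4.4 (arXiv 0711.4948: Prop. 11; proof of Thm. 10, p. 12, Fig. 6). [Nolin2008]
* H. Kesten, *Scaling relations for 2D-percolation*, Comm. Math. Phys. 109 (1987), Lemma 4.
  [Kesten1987]
-/

noncomputable section

namespace Literature.Probability.Percolation

open LatticeModels Tube

namespace Staircase

/-- **Assembly through a connector**: two chains joined by a tube crossing the last tube of the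
first and the first tube of the second form a chain. [folklore] -/
theorem isChain_append_conn {L₁ L₂ : List Tube} {c : Tube} (h₁ : List.IsChain Crosses L₁) (h₂ : List.IsChain Crosses L₂)
    (hx : ∀ x ∈ L₁.getLast?, Crosses x c) (hy : ∀ y ∈ L₂.head?, Crosses c y) :
    List.IsChain Crosses (L₁ ++ c :: L₂) :=
  h₁.append (List.isChain_cons.2 ⟨hy, h₂⟩) fun x hx' y hy' => by
    rw [List.head?_cons, Option.mem_def, Option.some.injEq] at hy'
    subst hy'
    exact hx x hx'

/-- The number of tubes from the position `g₁` up to the position `g₂` of a cyclic list of `G`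
tubes, both included. [folklore] -/
def ccwLen (G g₁ g₂ : ℕ) : ℕ := (g₂ + G - g₁) % G + 1

/-- `1 ≤ ccwLen ≤ G` (`0 < G`). [folklore] -/
theorem ccwLen_le {G g₁ g₂ : ℕ} (hG : 0 < G) : 1 ≤ ccwLen G g₁ g₂ ∧ ccwLen G g₁ g₂ ≤ G := by
  unfold ccwLen
  have := Nat.mod_lt (g₂ + G - g₁) hG
  omega

/-- **The directed arc** of the thin ring `thinRing r e s` from the position `g₁` to the position
`g₂`: counterclockwise (`cw = false`: the positions `g₁, g₁ + 1, …, g₂` cyclically) or clockwise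
(`cw = true`: `g₁, g₁ - 1, …, g₂`, the reversed counterclockwise arc from `g₂` to `g₁`). [cite: Nolin2008, §4.3 Prop. 12 (proof) and §4.4 (arXiv 0711.4948: Prop. 11; Thm. 10, p. 12, Fig. 6)] -/
def darc (r e s g₁ g₂ : ℕ) (cw : Bool) : List Tube :=
  bif cw then (arc (thinRing r e s) g₂ (ccwLen (12 * (r / s) - 4) g₂ g₁)).reverse
  else arc (thinRing r e s) g₁ (ccwLen (12 * (r / s) - 4) g₁ g₂)

variable {r e s : ℕ}

/-- **Directed arcs are chains** (`1 ≤ s`, `s ∣ r`, `s ≤ r`). [folklore] -/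
theorem isChain_darc (hs : 1 ≤ s) (hsr : s ∣ r) (hr : s ≤ r) (g₁ g₂ : ℕ) (cw : Bool) :
    List.IsChain Crosses (darc r e s g₁ g₂ cw) := by
  cases cw
  · exact isChain_arc_thinRing hs hsr hr _ _
  · exact isChain_reverse (isChain_arc_thinRing hs hsr hr _ _)

/-- The first tube of a counterclockwise arc. [folklore] -/
theorem head?_arc_ccw (hr : 1 ≤ r / s) {g₁ g₂ : ℕ} (hg₁ : g₁ < 12 * (r / s) - 4) :
    (arc (thinRing r e s) g₁ (ccwLen (12 * (r / s) - 4) g₁ g₂)).head? = some (ringTube r e s g₁) := by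
  have hG := length_thinRing (e := e) hr
  rw [head?_arc (ccwLen_le (by omega)).1 (by rw [hG]; exact hg₁), getElem?_thinRing hr hg₁]

/-- The last tube of a counterclockwise arc. [folklore] -/
theorem getLast?_arc_ccw (hr : 1 ≤ r / s) {g₁ g₂ : ℕ} (hg₁ : g₁ < 12 * (r / s) - 4) (hg₂ : g₂ < 12 * (r / s) - 4) :
    (arc (thinRing r e s) g₁ (ccwLen (12 * (r / s) - 4) g₁ g₂)).getLast? = some (ringTube r e s g₂) := by
  have hG := length_thinRing (e := e) hr
  obtain ⟨h1, h2⟩ := ccwLen_le (G := 12 * (r / s) - 4) (g₁ := g₁) (g₂ := g₂) (by omega)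
  rw [List.getLast?_eq_getElem?, length_arc (by rw [hG]; exact h2),
    getElem?_arc (by omega) (by rw [hG]; omega), hG]
  have hidx : (ccwLen (12 * (r / s) - 4) g₁ g₂ - 1 + g₁) % (12 * (r / s) - 4) = g₂ := by
    unfold ccwLen
    rw [Nat.add_sub_cancel]
    exact mod_sub_add_cancel hg₁ hg₂
  rw [hidx, getElem?_thinRing hr hg₂]

/-- **The first tube of a directed arc** is the ring tube at `g₁`. [folklore] -/
theorem head?_darc (hr : 1 ≤ r / s) {g₁ g₂ : ℕ} (hg₁ : g₁ < 12 * (r / s) - 4) (hg₂ : g₂ < 12 * (r / s) - 4) (cw : Bool) :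
    (darc r e s g₁ g₂ cw).head? = some (ringTube r e s g₁) := by
  cases cw
  · exact head?_arc_ccw hr hg₁
  · show (arc (thinRing r e s) g₂ _).reverse.head? = _
    rw [List.head?_reverse, getLast?_arc_ccw hr hg₂ hg₁]

/-- **The last tube of a directed arc** is the ring tube at `g₂`. [folklore] -/
theorem getLast?_darc (hr : 1 ≤ r / s) {g₁ g₂ : ℕ} (hg₁ : g₁ < 12 * (r / s) - 4) (hg₂ : g₂ < 12 * (r / s) - 4) (cw : Bool) :
    (darc r e s g₁ g₂ cw).getLast? = some (ringTube r e s g₂) := by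
  cases cw
  · exact getLast?_arc_ccw hr hg₁ hg₂
  · show (arc (thinRing r e s) g₂ _).reverse.getLast? = _
    rw [List.getLast?_reverse, head?_arc_ccw hr hg₂]

/-- **The tubes of a directed arc, by position**: every tube is `ringTube r e s g` for a position
`g` on the counterclockwise arc from `g₁` to `g₂` (`cw = false`) or from `g₂` to `g₁`
(`cw = true`). [folklore] -/
theorem exists_pos_of_mem_darc (hr : 1 ≤ r / s) {g₁ g₂ : ℕ} (hg₁ : g₁ < 12 * (r / s) - 4) (hg₂ : g₂ < 12 * (r / s) - 4)
    {cw : Bool} {T : Tube} (hT : T ∈ darc r e s g₁ g₂ cw) :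
    ∃ g, g < 12 * (r / s) - 4 ∧ T = ringTube r e s g ∧
      (bif cw then InArc (12 * (r / s) - 4) g₂ (ccwLen (12 * (r / s) - 4) g₂ g₁) g
        else InArc (12 * (r / s) - 4) g₁ (ccwLen (12 * (r / s) - 4) g₁ g₂) g) := by
  cases cw
  · obtain ⟨g, hg, hin, hTg⟩ := exists_pos_of_mem_arc hr hg₁ (ccwLen_le (by omega)).2 hT
    exact ⟨g, hg, hTg, hin⟩
  · have hT' : T ∈ arc (thinRing r e s) g₂ (ccwLen (12 * (r / s) - 4) g₂ g₁) := List.mem_reverse.1 hT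
    obtain ⟨g, hg, hin, hTg⟩ := exists_pos_of_mem_arc hr hg₂ (ccwLen_le (by omega)).2 hT'
    exact ⟨g, hg, hTg, hin⟩

/-- The tubes of a directed arc are tubes of the ring. [folklore] -/
theorem mem_thinRing_of_mem_darc {g₁ g₂ : ℕ} {cw : Bool} {T : Tube} (hT : T ∈ darc r e s g₁ g₂ cw) : T ∈ thinRing r e s := by
  cases cw
  · exact mem_of_mem_arc hT
  · exact mem_of_mem_arc (List.mem_reverse.1 hT)

/-- The ring tubes at the two ends belong to the directed arc. [folklore] -/
theorem ringTube_mem_darc (hr : 1 ≤ r / s) {g₁ g₂ : ℕ} (hg₁ : g₁ < 12 * (r / s) - 4) (hg₂ : g₂ < 12 * (r / s) - 4) (cw : Bool) :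
    ringTube r e s g₁ ∈ darc r e s g₁ g₂ cw ∧ ringTube r e s g₂ ∈ darc r e s g₁ g₂ cw :=
  ⟨List.mem_of_mem_head? (by rw [head?_darc hr hg₁ hg₂]; rfl), List.mem_of_getLast? (by rw [getLast?_darc hr hg₁ hg₂])⟩

end Staircase

end Literature.Probability.Percolation
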